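import Summits.ValiantsHypothesis.ValiantsHypothesis.Theorems.DefinabilityGapFreeAxes
import HarnessLib

/-!
# DefinabilityGap — the corank flag: every frozen SINGULAR position costs its corank (kernel)

Helper under **the leaf the read-once route asks for**, stmt-23704 `KIPlantedHittingRO`
(*leaf asks width `q^b`, degree `q^b`, arbitrary read-once order `π`*), rev-10 route
`Theses/DefinabilityGap.lean` (DRAFT); `P_c = kiPer m c`, `φ = bind₁ (kiPer m)`.  Third file of
the lineage-5 g34 node, on top of `DefinabilityGapSkeletonFlag.lean` (the `(w − 1)`-support
witness for NONSINGULAR chains) and `DefinabilityGapFreeAxes.lean` (the multi-block free axes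
`Θ_{S,ι,i₀,t}`).  **0 S-currency · closes NO item · the leaf 23704, the K1 / F4 / W10 tags,
rev-10 `closes` and `VP ≠ VNP` are untouched.**

## What is proved — singular links, priced by corank

The skeleton flag of `…SkeletonFlag` needed every skeleton matrix `B_i = P_i(t)` invertible:
a frozen position then never loses a dimension.  Here the skeleton matrices are ARBITRARY, and
the one new inequality is (`finrank_le_finrank_map_add`)
`dim T ≤ dim (B_i · T) + (w − rank B_i)` — a frozen singular position loses at most its CORANK.
Running the same flag recursion with this potential:

* §1 ★ `exists_flag_corank`: for every `N`, every `B : Fin N → M_w(ℂ)` (no hypothesis) and every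
  free-link data `P`, the full span `Γ_N` of the selected vectors is already `Γ_j` for some `j`
  with `j + 1 ≤ dim Γ_N + ∑ i, (w − rank B_i)`; hence (`dotProduct_selProd_eq_zero_corank`) a
  covector killing all selections with `≤ (w − 1) + ∑ i, (w − rank B_i)` free positions kills
  every selection.
* §2 ★ `chainPoly_eq_zero_of_restrict_corank`: a read-once chain
  `uᵀ P_1(z_{π 1}) ⋯ P_N(z_{π N}) v` of ARBITRARY univariate polynomial links whose restrictions to
  at most `(w − 1) + ∑ i, (w − rank P_i(t))` free variables (the others frozen at `t`) all vanish
  is the zero polynomial — for EVERY base point `t`.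
* §3 ★ `kiPer_hits_chainPoly_corank`: with `3 ≤ m` and
  `2·((w − 1) + ∑ i, (w − rank P_i(t))) < m` for some `t`, a nonzero chain stays nonzero under
  `φ` (the free-axes substitution of `…FreeAxes` supplies every restriction to `< m/2` free
  variables as an algebra-hom image of `φ D`).  The nonsingular theorem
  `…FreeAxes.kiPer_hits_chainPoly` is the case of total corank `0`
  (`kiPer_hits_chainPoly_of_det_eval_ne_zero`: `det P_i(t) ≠ 0 ⇒ rank = w`, bound `2w ≤ m + 1`
  recovered).  Corollary `kiPer_hits_matrixProduct_corank` in the `(List.ofFn M).prod a b`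
  currency of `Literature…FSV18SuccinctGenerators.IsROABP`, the ranks read off the layers
  evaluated at the point `(t, …, t)`.

## Honest label · placement on the width road

ELEMENTARY · VARIANT.  The potential `dim Γ + ∑ corank` is the classical evaluation-dimension
bookkeeping for read-once products ([Nisan1991Noncommutative]; [ForbesShpilka2013]; the ROABP
low-support lineage [SahaSaptharishiSaxena2009], Agrawal–Saha–Saxena 2013,
[ForbesSaptharishiShpilka2014], Gurjar–Korwar–Saxena 2016) run at a single base point and priced
by corank; ROABP hitting itself is CLASSICAL [KabanetsImpagliazzo2003 for the generator]; new
only in `G_m`'s currency (the transfer through `φ` by the free axes).  The price is sharp: the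
width-2 chain `∏_{i ≤ k} (z_{2i−1} − z_{2i})` with `k − 1` rank-one connector links has total
corank `k − 1` at every base point, and its restrictions to `≤ k − 1` free variables all vanish
while the threshold of the theorem is exactly `(w − 1) + (k − 1) = k`.  Rung «read-once chains
of width `w` and TOTAL CORANK `κ` at some base point, `2(w − 1 + κ) < m`» strictly under leaf
23704; it contains the nonsingular rung (`κ = 0`).  NOT claimed: chains whose total corank is
`≥ m/2 − w + 1` at every base point (many singular links — there rank-one links still split the
chain into a product, which `φ` respects over the domain `MvPolynomial _ ℂ`, but bottleneck links
of rank `2 … w − 1` in number `≳ m/2` are IDEA-NEEDED), and the leaf regime `w = q^b ≫ m`, where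
already `2(w − 1) < m` fails.  The bound is what the free-block budget `2·|S| < m` affords, NOT
claimed optimal.
0 S-currency; closes NO item. [rung total corank under leaf 23704 · 0 S-currency · closes NO item]

## Worked instances (members of the NEW class)

* `w = 3`, order `z_1, …, z_6`, `m ≥ 7`:
  `D' = (2z_1z_2 − (z_1+z_2)(z_3+z_4) + 2z_3z_4)·(z_5 − z_6) + z_1z_2
      = e_0ᵀ·L_1(z_1)L_2(z_2)L_3(z_3)L_4(z_4)N_5(z_5)N_6(z_6)·e_0` with
  `L_1 = [[1,z,0],[0,1,0],[0,0,1]]`, `L_2 = [[1,z,0],[0,1,z],[0,0,1]]`,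
  `L_3 = [[2z,0,0],[−1,−z,0],[0,0,1]]` (`det = −2z²`), `L_4 = [[z,0,0],[1,0,0],[2,1,0]]` (RANK 2
  for every `z`: a singular link of rank strictly between `1` and `w`, so the chain does not split
  into a product there and `…FreeAxes` does not apply to this realization),
  `N_5 = [[1,z,0],[0,1,0],[0,0,1]]`, `N_6 = [[−z,1,0],[1,0,0],[0,0,1]]` (`det = −1`): total corank
  `1` at every `t ≠ 0`, `2·(2 + 1) = 6 < 7`; `D'` is irreducible and width-3-essential (cut-rank
  `3` after `z_2`).  Whether `D'` also admits a realization with all links nonsingular is NOT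
  claimed either way.
* `w = 3`, `m ≥ 9`: `D = (2z_1z_2 − (z_1+z_2)(z_3+z_4) + 2z_3z_4)·(z_5 − z_6)` (replace `L_4` by the
  rank-one `[[z,0,0],[1,0,0],[2,0,0]]`, total corank `2`).  Every restriction of `D` to `≤ 2` free
  variables vanishes at EVERY base point, so by `…SkeletonFlag.chainPoly_eq_zero_of_restrict` NO
  width-3 realization of `D` (in any read order) has all links nonsingular at any `t`: `D` is
  provably outside the nonsingular rung (honestly: being a product of two hit polynomials it is also
  settled by hand through the multiplicativity of `φ`; `D'` is not a product).
-/

noncomputable section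

open MvPolynomial

open scoped Polynomial

open Literature.Computability.AlgebraicComplexity Literature.Computability.MetaComplexity

open Summit.ValiantsHypothesis.ValiantsHypothesis.Theorems.DefinabilityGapAffineRung

open Summit.ValiantsHypothesis.ValiantsHypothesis.Theorems.DefinabilityGapSkeletonFlag

open Summit.ValiantsHypothesis.ValiantsHypothesis.Theorems.DefinabilityGapFreeAxes

set_option linter.dupNamespace false

namespace Summit.ValiantsHypothesis.ValiantsHypothesis.Theorems.DefinabilityGapCorankFlag

variable {w N : ℕ}

/-! ## 1. The corank flag -/

/-- THE CORANK PRICE.  A subspace loses at most `w − rank B` dimensions under `B`. -/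
theorem finrank_le_finrank_map_add (B : Matrix (Fin w) (Fin w) ℂ) (T : Submodule ℂ (Fin w → ℂ)) :
    Module.finrank ℂ T ≤ Module.finrank ℂ (T.map B.mulVecLin) + (w - B.rank) := by
  have h1 := LinearMap.finrank_range_add_finrank_ker (B.mulVecLin.domRestrict T)
  rw [LinearMap.range_domRestrict, LinearMap.ker_domRestrict] at h1
  have h2 : Module.finrank ℂ ((LinearMap.ker B.mulVecLin).comap T.subtype) ≤
      Module.finrank ℂ (LinearMap.ker B.mulVecLin) := by
    rw [← Submodule.finrank_map_subtype_eq T, Submodule.map_comap_subtype]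
    exact Submodule.finrank_mono inf_le_right
  have h3 := LinearMap.finrank_range_add_finrank_ker B.mulVecLin
  rw [Module.finrank_fin_fun] at h3
  have h4 : B.rank = Module.finrank ℂ (LinearMap.range B.mulVecLin) := rfl
  omega

/-- ★ THE CORANK FLAG.  For ARBITRARY skeleton matrices the full span `Γ_N` is already `Γ_j`
for some `j` with `j + 1 ≤ dim Γ_N + ∑ i, (w − rank B_i)`: every free position either leaves the
image of the flag unchanged or raises its dimension, and a frozen position lowers the dimension
by at most its corank. -/
theorem exists_flag_corank {v : Fin w → ℂ} (hv : v ≠ 0) :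
    ∀ (N : ℕ) (B : Fin N → Matrix (Fin w) (Fin w) ℂ) (P : Fin N → ℂ → Matrix (Fin w) (Fin w) ℂ),
      ∃ j, j + 1 ≤ Module.finrank ℂ (gam B P v N) + ∑ i, (w - (B i).rank) ∧
        gam B P v N ≤ gam B P v j
  | 0, B, P => by
    refine ⟨0, ?_, le_rfl⟩
    have hmem : v ∈ gam B P v 0 := by
      have h := mem_gam (B := B) (P := P) (v := v) (s := 0) (a := fun _ => none)
        (by simp [freeCount])
      rwa [selProd, List.ofFn_zero, List.prod_nil, Matrix.one_mulVec] at h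
    have h1 : 1 ≤ Module.finrank ℂ (gam B P v 0) := by
      rw [← finrank_span_singleton (K := ℂ) hv]
      exact Submodule.finrank_mono ((Submodule.span_singleton_le_iff_mem v _).2 hmem)
    omega
  | N + 1, B, P => by
    obtain ⟨j, hj, hle⟩ := exists_flag_corank hv N (Fin.tail B) (Fin.tail P)
    have hrank := finrank_le_finrank_map_add (B 0) (gam (Fin.tail B) (Fin.tail P) v N)
    have hsum : ∑ i, (w - (B i).rank) = (w - (B 0).rank) + ∑ i, (w - (Fin.tail B i).rank) :=
      Fin.sum_univ_succ _
    have h1 : (gam (Fin.tail B) (Fin.tail P) v N).map (B 0).mulVecLin ≤ gam B P v (N + 1) :=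
      (map_skel_le B P v N).trans (gam_mono B P v N.le_succ)
    have h2 : ∀ x, (gam (Fin.tail B) (Fin.tail P) v N).map (P 0 x).mulVecLin ≤ gam B P v (N + 1) :=
      fun x => map_free_le B P v x N
    have h1' := Submodule.finrank_mono h1
    by_cases hc : (⨆ x : ℂ, (gam (Fin.tail B) (Fin.tail P) v N).map (P 0 x).mulVecLin) ≤
        (gam (Fin.tail B) (Fin.tail P) v N).map (B 0).mulVecLin
    · refine ⟨j, by omega, (gam_succ_le B P v).trans (sup_le ?_ (hc.trans ?_))⟩ <;>
        exact (Submodule.map_mono hle).trans (map_skel_le B P v j)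
    · have hlt : (gam (Fin.tail B) (Fin.tail P) v N).map (B 0).mulVecLin < gam B P v (N + 1) :=
        lt_of_le_of_ne h1 fun heq => hc (by rw [heq]; exact iSup_le h2)
      have hlt' := Submodule.finrank_lt_finrank_of_lt hlt
      refine ⟨j + 1, by omega, (gam_succ_le B P v).trans (sup_le ?_ (iSup_le fun x => ?_))⟩
      · exact ((Submodule.map_mono hle).trans (map_skel_le B P v j)).trans
          (gam_mono B P v j.le_succ)
      · exact (Submodule.map_mono hle).trans (map_free_le B P v x j)

/-- THE CORANK SELECTION PRINCIPLE.  A covector orthogonal to every selected vector with at most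
`(w − 1) + ∑ i, (w − rank B_i)` free positions is orthogonal to every selected vector. -/
theorem dotProduct_selProd_eq_zero_corank (B : Fin N → Matrix (Fin w) (Fin w) ℂ)
    (P : Fin N → ℂ → Matrix (Fin w) (Fin w) ℂ) (u v : Fin w → ℂ)
    (h : ∀ a : Fin N → Option ℂ, freeCount a ≤ (w - 1) + ∑ i, (w - (B i).rank) →
      u ⬝ᵥ (selProd B P a).mulVec v = 0)
    (a : Fin N → Option ℂ) : u ⬝ᵥ (selProd B P a).mulVec v = 0 := by
  by_cases hv : v = 0
  · rw [hv, Matrix.mulVec_zero, dotProduct_zero]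
  obtain ⟨j, hj, hle⟩ := exists_flag_corank hv N B P
  have hw : Module.finrank ℂ (gam B P v N) ≤ w :=
    (Submodule.finrank_le _).trans (Module.finrank_fin_fun ℂ).le
  have hmem : (selProd B P a).mulVec v ∈ gam B P v ((w - 1) + ∑ i, (w - (B i).rank)) :=
    gam_mono B P v (by omega) (hle (mem_gam (freeCount_le a)))
  refine Submodule.span_induction (p := fun x _ => u ⬝ᵥ x = 0) (fun x hx => ?_)
    (dotProduct_zero u)
    (fun x y _ _ hx hy => show u ⬝ᵥ (x + y) = 0 by
      rw [dotProduct_add, show u ⬝ᵥ x = 0 from hx, show u ⬝ᵥ y = 0 from hy, add_zero])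
    (fun c x _ hx => show u ⬝ᵥ (c • x) = 0 by
      rw [dotProduct_smul, show u ⬝ᵥ x = 0 from hx, smul_zero]) hmem
  obtain ⟨a', ha', rfl⟩ := hx
  exact h a' ha'

/-! ## 2. Chains with arbitrary univariate links -/

section Chains

variable {σ : Type*}

/-- ★ THE CORANK WITNESS THEOREM.  A read-once chain of ARBITRARY univariate polynomial
matrices whose restrictions to at most `(w − 1) + ∑ i, (w − rank P_i(t))` free variables (the
others frozen at `t`) all vanish is the zero polynomial — for every base point `t`.
[generator-free instrument · 0 S-currency · closes no item] -/
theorem chainPoly_eq_zero_of_restrict_corank [DecidableEq σ] (π : Fin N → σ)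
    (hπ : Function.Injective π) (P : Fin N → Matrix (Fin w) (Fin w) ℂ[X]) (u v : Fin w → ℂ)
    (t : ℂ)
    (hres : ∀ S : Finset σ, S.card ≤ (w - 1) + ∑ i, (w - ((P i).map (Polynomial.eval t)).rank) →
      aeval (fun b => if b ∈ S then X b else (C t : MvPolynomial σ ℂ)) (chainPoly π P u v) = 0) :
    chainPoly π P u v = 0 := by
  refine MvPolynomial.funext fun y => ?_
  rw [map_zero, eval_chainPoly]
  have hsmall : ∀ a : Fin N → Option ℂ,
      freeCount a ≤ (w - 1) + ∑ i, (w - ((P i).map (Polynomial.eval t)).rank) →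
      u ⬝ᵥ (selProd (fun i => (P i).map (Polynomial.eval t))
        (fun i s => (P i).map (Polynomial.eval s)) a).mulVec v = 0 := by
    intro a ha
    obtain ⟨S, hS, z, hz⟩ := exists_eval_restrict_eq π hπ P u v t a
    rw [← hz, hres S (hS.trans ha), map_zero]
  have key := dotProduct_selProd_eq_zero_corank (fun i => (P i).map (Polynomial.eval t))
    (fun i s => (P i).map (Polynomial.eval s)) u v hsmall (fun i => some (y (π i)))
  simpa only [selProd, Option.elim] using key

end Chains

/-! ## 3. `G_m` hits every read-once chain of small total corank -/

variable {m : ℕ}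

/-- ★ For `3 ≤ m`, a base point `t` with `2·((w − 1) + ∑ i, (w − rank P_i(t))) < m`, an injective
read order and ARBITRARY univariate links, a nonzero chain polynomial stays nonzero under `φ`.
[rung total corank · 0 S-currency · closes no item · total corank ≥ m/2 − w + 1 and w = q^b NOT
claimed] -/
theorem kiPer_hits_chainPoly_corank (hm : 3 ≤ m) {w N : ℕ}
    (π : Fin N → (Fin 3 → Fin (qOf m))) (hπ : Function.Injective π)
    (P : Fin N → Matrix (Fin w) (Fin w) ℂ[X]) (u v : Fin w → ℂ) (t : ℂ)
    (hκ : 2 * ((w - 1) + ∑ i, (w - ((P i).map (Polynomial.eval t)).rank)) < m)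
    (hD : chainPoly π P u v ≠ 0) : bind₁ (kiPer m) (chainPoly π P u v) ≠ 0 := fun h =>
  hD (chainPoly_eq_zero_of_restrict_corank π hπ P u v t fun S hS =>
    aeval_restrict_eq_zero hm S (by omega) t h)

/-- The nonsingular rung as the case of total corank `0`: links nonsingular at the base point
`t` and `2w ≤ m + 1` (= `…FreeAxes.kiPer_hits_chainPoly` with the base point exposed). -/
theorem kiPer_hits_chainPoly_of_det_eval_ne_zero (hm : 3 ≤ m) {w N : ℕ} (hw : 2 * w ≤ m + 1)
    (π : Fin N → (Fin 3 → Fin (qOf m))) (hπ : Function.Injective π)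
    (P : Fin N → Matrix (Fin w) (Fin w) ℂ[X]) (u v : Fin w → ℂ) (t : ℂ)
    (hdet : ∀ i, ((P i).map (Polynomial.eval t)).det ≠ 0)
    (hD : chainPoly π P u v ≠ 0) : bind₁ (kiPer m) (chainPoly π P u v) ≠ 0 := by
  refine kiPer_hits_chainPoly_corank hm π hπ P u v t ?_ hD
  have h0 : ∑ i, (w - ((P i).map (Polynomial.eval t)).rank) = 0 :=
    Finset.sum_eq_zero fun i _ => by
      show w - ((P i).map (Polynomial.eval t)).rank = 0
      rw [Matrix.rank_of_isUnit _ ((Matrix.isUnit_iff_isUnit_det _).2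
        (isUnit_iff_ne_zero.2 (hdet i))), Fintype.card_fin, Nat.sub_self]
  omega

/-- ★ in matrix-product currency (`Literature…FSV18SuccinctGenerators.IsROABP` unfolds to such a
product): layers `M_i` univariate in `z_{π i}` (`π` injective), width `w`, `m ≥ 3`, and a base
point `t` with `2·((w − 1) + ∑ i, (w − rank M_i(t, …, t))) < m` (every variable
evaluated at `t`) — any nonzero entry of
`M_1 ⋯ M_N` stays nonzero under `φ`. -/
theorem kiPer_hits_matrixProduct_corank (hm : 3 ≤ m) {w N : ℕ}
    (π : Fin N → (Fin 3 → Fin (qOf m))) (hπ : Function.Injective π)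
    (M : Fin N → Matrix (Fin w) (Fin w) (MvPolynomial (Fin 3 → Fin (qOf m)) ℂ))
    (hM : ∀ i a b, ∃ p : ℂ[X],
      M i a b = Polynomial.aeval (X (π i) : MvPolynomial (Fin 3 → Fin (qOf m)) ℂ) p)
    (t : ℂ)
    (hκ : 2 * ((w - 1) + ∑ i, (w - ((M i).map (eval (Function.const _ t))).rank)) < m)
    (a b : Fin w) (hD : (List.ofFn M).prod a b ≠ 0) :
    bind₁ (kiPer m) ((List.ofFn M).prod a b) ≠ 0 := by
  classical
  choose p hp using hM
  have hMP : ∀ i, M i = (Matrix.of (p i)).map (Polynomial.aeval (X (π i))) := fun i =>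
    Matrix.ext fun a b => by rw [Matrix.map_apply, Matrix.of_apply]; exact hp i a b
  have hev : ∀ i, (M i).map (eval (Function.const _ t)) =
      (Matrix.of (p i)).map (Polynomial.eval t) := fun i => by
    rw [hMP i, Matrix.map_map]
    refine congrArg _ (funext fun q => ?_)
    show (aeval (Function.const _ t)) (Polynomial.aeval (X (π i)) q) = Polynomial.eval t q
    rw [← Polynomial.aeval_algHom_apply, aeval_X, Function.const_apply,
      Polynomial.coe_aeval_eq_eval]
  have hκ' : 2 * ((w - 1) + ∑ i, (w - ((Matrix.of (p i)).map (Polynomial.eval t)).rank)) < m := by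
    simpa only [hev] using hκ
  have hL : (List.ofFn fun i => (Matrix.of (p i)).map (Polynomial.aeval (X (π i)))) = List.ofFn M :=
    congrArg List.ofFn (funext fun i => (hMP i).symm)
  have hval : (List.ofFn M).prod a b =
      chainPoly π (fun i => Matrix.of (p i)) (Pi.single a 1) (Pi.single b 1) := by
    rw [chainPoly, hL, dotProduct, Fintype.sum_eq_single a fun j hj => by
      rw [Pi.single_eq_of_ne hj, C_0, zero_mul], Pi.single_eq_same, C_1, one_mul]
    simp only [Matrix.mulVec, dotProduct]
    rw [Fintype.sum_eq_single b fun j hj => by rw [Pi.single_eq_of_ne hj, C_0, mul_zero],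
      Pi.single_eq_same, C_1, mul_one]
  rw [hval] at hD ⊢
  exact kiPer_hits_chainPoly_corank hm π hπ (fun i => Matrix.of (p i)) _ _ t hκ' hD

end Summit.ValiantsHypothesis.ValiantsHypothesis.Theorems.DefinabilityGapCorankFlag

end
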